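import Mathlib
import Literature.Analysis.UnboundedOperators.HeatFlowCalculus
import Summits.NavierStokesRegularity.NavierStokesRegularity.Theorems.PlaneEnergyCeilingPlanarEnergyAPrioriHeatKernel1D
import Summits.NavierStokesRegularity.NavierStokesRegularity.Theorems.PlaneEnergyCeilingPlanarEnergyAPrioriTimeIntegratedEnergy
import Summits.NavierStokesRegularity.NavierStokesRegularity.Theorems.PlaneEnergyCeilingPlanarEnergyAPrioriPlanarFlux

/-!
# Route PlaneEnergyCeiling · crux `PlanarEnergyAPriori` — the mild slab law, time side

Helper file for the crux item stmt-NavierStokesRegularity-16855 (`PlanarEnergyAPriori`, route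
`PlaneEnergyCeiling`), toward the registered stub `stub_slabLawMild` of the line
`Cruxes/PlanarEnergyAPriori/Lines/birth.lean` (THE SLAB ENERGY LAW IN MILD FORM). With the caloric
weight `W(τ,x) = G_{ν(t−τ)}(x₂ − c₀)` along a classical solution on `[0,t]` with order-(3,2) decay:

* `slabLaw_timeIntegration` — for `0 < s₁ < t`,
  `∫ W(s₁)|u(s₁)|² − ∫ W(0)|u(0)|² = ∫₀^{s₁}∫ (W'|u|² + W·2⟪acc,u⟫)`, `W' = ∂_τW = −νG''`
  (landed `integral_Ioo_integral_weightedEnergy_deriv` + `hasDerivAt_heatKernel_backward`; the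
  density is dominated by `A(1+‖x‖)⁻⁵` uniformly in `τ ≤ s₁`);
* `tendsto_integral_planarEnergy_mul_heatKernel` — the planar energies
  `e(s,c) = ∫_{x₂=c}|u(s)|²` are continuous in `c`, bounded, and Lipschitz in time (the tendency
  field decays like `(1+‖x‖)⁻²`), so `∫ e(s,c) G_{ν(t−s)}(c − c₀) dc → e(t,c₀)` as `s ↑ t` (landed
  `tendsto_integral_mul_heatKernel`).

Folklore (Evans, *PDE*, §2.3; the Duhamel formula for the 1-D slab law).
-/

noncomputable section

-- single-conjunct summit: `Summit.<Summit>.<Problem>` repeats the name by the D-0017 layout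
set_option linter.dupNamespace false

namespace Summit.NavierStokesRegularity.NavierStokesRegularity.Theorems.PlanarEnergyAPriori

open MeasureTheory Set Filter Topology Function WithLp Real
open scoped ENNReal RealInnerProductSpace Laplacian
open Literature.Analysis.FluidPDE Literature.Analysis.UnboundedOperators
open Summit.NavierStokesRegularity.NavierStokesRegularity.Theorems.PlaneEnergyCeilingSlabEnergyIdentity
open Summit.NavierStokesRegularity.NavierStokesRegularity.Theorems.PlanarEnergyAPriori.SlabLaw

variable {ν t : ℝ} {u : ℝ → EuclideanSpace ℝ (Fin 3) → EuclideanSpace ℝ (Fin 3)} {p : ℝ → EuclideanSpace ℝ (Fin 3) → ℝ} {C : ℝ}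

/-! ### Uniform bounds on the caloric weight for `τ ≤ s₁ < t` -/

/-- `(4πσ)^{-1/2}` is antitone in `σ > 0`. -/
theorem rpow_neg_half_antitone {σ₁ σ : ℝ} (hσ₁ : 0 < σ₁) (h : σ₁ ≤ σ) :
    (4 * π * σ) ^ (-(1 : ℝ) / 2) ≤ (4 * π * σ₁) ^ (-(1 : ℝ) / 2) :=
  Real.rpow_le_rpow_of_nonpos (by positivity) (by nlinarith [Real.pi_pos]) (by norm_num)

/-! ### Time integration with the caloric weight -/

/-- **Time integration of the caloric-weighted energy.** For a classical solution on `[0,t]` with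
order-(3,2) decay, `c₀ ∈ ℝ` and `0 < s₁ < t`: with `W(τ,x) = G_{ν(t−τ)}(x₂−c₀)` and
`W' = ∂_τW = −ν G_{ν(t−τ)}''(x₂ − c₀)`,
`∫_{(0,s₁)}∫ (W'|u|² + W·2⟪νΔu − (u·∇)u − ∇p, u⟫) = ∫ W(s₁)|u(s₁)|² − ∫ W(0)|u(0)|²`. [folklore] -/
theorem slabLaw_timeIntegration (hν : 0 < ν) (ht : 0 < t) (hcl : IsClassicalNSSolutionOn (Icc 0 t) ν 0 u p)
    (h0 : ∀ s ∈ Icc 0 t, ∀ x, ‖u s x‖ ≤ C * (1 + ‖x‖) ^ (-(3 : ℝ)))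
    (h1 : ∀ s ∈ Icc 0 t, ∀ x, ‖fderiv ℝ (u s) x‖ ≤ C * (1 + ‖x‖) ^ (-(3 : ℝ)))
    (h2 : ∀ s ∈ Icc 0 t, ∀ x, ‖iteratedFDeriv ℝ 2 (u s) x‖ ≤ C * (1 + ‖x‖) ^ (-(3 : ℝ)))
    (k1 : ∀ s ∈ Icc 0 t, ∀ x, ‖gradient (p s) x‖ ≤ C * (1 + ‖x‖) ^ (-(2 : ℝ)))
    (c₀ : ℝ) {s₁ : ℝ} (hs₁ : 0 < s₁) (hs₁t : s₁ < t) :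
    ∫ τ in Ioo 0 s₁, ∫ x, (-ν * (((x 2 - c₀) ^ 2 / (4 * (ν * (t - τ)) ^ 2) - 1 / (2 * (ν * (t - τ)))) *
        heatKernel (ν * (t - τ)) (x 2 - c₀)) * ‖u τ x‖ ^ 2 +
        heatKernel (ν * (t - τ)) (x 2 - c₀) *
          (2 * ⟪ν • Δ (u τ) x - convect (u τ) (u τ) x - gradient (p τ) x, u τ x⟫)) =
      (∫ x, heatKernel (ν * (t - s₁)) (x 2 - c₀) * ‖u s₁ x‖ ^ 2) -
        ∫ x, heatKernel (ν * t) (x 2 - c₀) * ‖u 0 x‖ ^ 2 := by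
  have hC : 0 ≤ C := nonneg_of_norm_le_rpow (h0 0 ⟨le_rfl, ht.le⟩)
  have hU₁ : UniqueDiffOn ℝ (Icc 0 s₁) := uniqueDiffOn_Icc hs₁
  have hsub : Icc 0 s₁ ⊆ Icc 0 t := Icc_subset_Icc_right hs₁t.le
  have hcl₁ : IsClassicalNSSolutionOn (Icc 0 s₁) ν 0 u p := hcl.mono hsub hU₁
  -- the weight and its time derivative
  set W : ℝ → EuclideanSpace ℝ (Fin 3) → ℝ := fun τ x => heatKernel (ν * (t - τ)) (x 2 - c₀) with hW
  set W' : ℝ → EuclideanSpace ℝ (Fin 3) → ℝ := fun τ x =>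
    -ν * (((x 2 - c₀) ^ 2 / (4 * (ν * (t - τ)) ^ 2) - 1 / (2 * (ν * (t - τ)))) *
      heatKernel (ν * (t - τ)) (x 2 - c₀)) with hW'
  have hσpos : ∀ τ, τ ≤ s₁ → 0 < ν * (t - τ) := fun τ hτ => mul_pos hν (by linarith)
  -- joint continuity on `[0,s₁] × ℝ³`
  have hmaps : MapsTo (fun q : ℝ × EuclideanSpace ℝ (Fin 3) => (ν * (t - q.1), q.2 2 - c₀))
      (Icc 0 s₁ ×ˢ univ) (Ioi (0 : ℝ) ×ˢ (univ : Set ℝ)) := fun q hq =>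
    ⟨hσpos q.1 hq.1.2, mem_univ _⟩
  have hin : Continuous fun q : ℝ × EuclideanSpace ℝ (Fin 3) => (ν * (t - q.1), q.2 2 - c₀) := by fun_prop
  have hWc : ContinuousOn (uncurry W) (Icc 0 s₁ ×ˢ univ) :=
    (continuousOn_uncurry_heatKernel' (E := ℝ)).comp hin.continuousOn hmaps
  have hWsc : ContinuousOn (uncurry W') (Icc 0 s₁ ×ˢ univ) := by
    have hpoly : ContinuousOn (fun q : ℝ × EuclideanSpace ℝ (Fin 3) =>
        (q.2 2 - c₀) ^ 2 / (4 * (ν * (t - q.1)) ^ 2) - 1 / (2 * (ν * (t - q.1)))) (Icc 0 s₁ ×ˢ univ) := by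
      refine ContinuousOn.sub (ContinuousOn.div (by fun_prop) (by fun_prop) fun q hq => ?_)
        (ContinuousOn.div continuousOn_const (by fun_prop) fun q hq => ?_)
      · have := hσpos q.1 hq.1.2; positivity
      · have := hσpos q.1 hq.1.2; positivity
    have : uncurry W' = fun q : ℝ × EuclideanSpace ℝ (Fin 3) =>
        -ν * (((q.2 2 - c₀) ^ 2 / (4 * (ν * (t - q.1)) ^ 2) - 1 / (2 * (ν * (t - q.1)))) * uncurry W q) := by
      funext q; rfl
    rw [this]
    exact continuousOn_const.mul (hpoly.mul hWc)
  have hWd : ∀ τ ∈ Ioo 0 s₁, ∀ x, HasDerivAt (fun σ => W σ x) (W' τ x) τ := fun τ hτ x =>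
    hasDerivAt_heatKernel_backward (hσpos τ hτ.2.le) (x 2 - c₀)
  -- uniform bounds on `[0,s₁]`
  set K0 : ℝ := (4 * π * (ν * (t - s₁))) ^ (-(1 : ℝ) / 2) with hK0
  have hK0nn : 0 ≤ K0 := by positivity
  have hWb : ∀ τ, τ ≤ s₁ → ∀ z, |heatKernel (ν * (t - τ)) (z - c₀)| ≤ K0 := fun τ hτ z => by
    rw [abs_of_nonneg (heatKernel_pos (hσpos τ hτ) _).le]
    exact (heatKernel_real_le (hσpos τ hτ) _).trans (rpow_neg_half_antitone (hσpos s₁ le_rfl) (by nlinarith))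
  have hW'b : ∀ τ, τ ≤ s₁ → ∀ z,
      |-ν * (((z - c₀) ^ 2 / (4 * (ν * (t - τ)) ^ 2) - 1 / (2 * (ν * (t - τ)))) * heatKernel (ν * (t - τ)) (z - c₀))| ≤
        ν * (K0 * (3 / (2 * (ν * (t - s₁))))) := fun τ hτ z => by
    have hσ := hσpos τ hτ
    rw [abs_mul, abs_neg, abs_of_pos hν]
    refine mul_le_mul_of_nonneg_left ((abs_deriv2_heatKernel_real_le hσ (z - c₀)).trans ?_) hν.le
    refine mul_le_mul (rpow_neg_half_antitone (hσpos s₁ le_rfl) (by nlinarith)) ?_ (by positivity) hK0nn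
    exact div_le_div_of_nonneg_left (by norm_num) (by have := hσpos s₁ le_rfl; positivity) (by nlinarith)
  -- the `(1+‖x‖)⁻⁵` majorant of the density
  set A : ℝ := ν * (K0 * (3 / (2 * (ν * (t - s₁))))) * C ^ 2 + 2 * K0 * C * (3 * ν * C + C ^ 2 + C) with hA
  have hA0 : 0 ≤ A := by have := hσpos s₁ le_rfl; positivity
  have hr : (Module.finrank ℝ (EuclideanSpace ℝ (Fin 3)) : ℝ) < 5 := by
    rw [finrank_euclideanSpace, Fintype.card_fin]; norm_num
  have hBint : Integrable fun x : EuclideanSpace ℝ (Fin 3) => A * (1 + ‖x‖) ^ (-(5 : ℝ)) :=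
    (integrable_one_add_norm hr).const_mul A
  have hBnn : ∀ x : EuclideanSpace ℝ (Fin 3), 0 ≤ A * (1 + ‖x‖) ^ (-(5 : ℝ)) := fun x =>
    mul_nonneg hA0 (rpow_neg_pos x 5).le
  have hdom : ∀ τ ∈ Icc 0 s₁, ∀ x,
      ‖W' τ x * ‖u τ x‖ ^ 2 + W τ x * (2 * ⟪timeDerivWithin (Icc 0 s₁) u τ x, u τ x⟫)‖ ≤
        A * (1 + ‖x‖) ^ (-(5 : ℝ)) := by
    intro τ hτ x
    have hτ' : τ ∈ Icc 0 t := hsub hτ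
    rw [timeDerivWithin_eq_acc hcl₁ hτ x, hA, add_mul]
    refine (norm_add_le _ _).trans (add_le_add ?_ ?_)
    · rw [norm_mul, Real.norm_eq_abs, Real.norm_of_nonneg (sq_nonneg _)]
      have h65 : (1 + ‖x‖) ^ (-(6 : ℝ)) ≤ (1 + ‖x‖) ^ (-(5 : ℝ)) := rpow_neg_le_rpow_neg_of_le x (by norm_num)
      calc |W' τ x| * ‖u τ x‖ ^ 2 ≤ ν * (K0 * (3 / (2 * (ν * (t - s₁))))) * (C ^ 2 * (1 + ‖x‖) ^ (-(6 : ℝ))) :=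
            mul_le_mul (hW'b τ hτ.2 (x 2)) (norm_sq_le_weight (h0 τ hτ' x)) (sq_nonneg _)
              (by have := hσpos s₁ le_rfl; positivity)
        _ ≤ ν * (K0 * (3 / (2 * (ν * (t - s₁))))) * (C ^ 2 * (1 + ‖x‖) ^ (-(5 : ℝ))) := by
            have := hσpos s₁ le_rfl; gcongr
        _ = _ := by ring
    · exact norm_weight_mul_two_inner_acc_le hν.le hC (h0 τ hτ' x) (h1 τ hτ' x) (h2 τ hτ' x) (k1 τ hτ' x)
        (hWb τ hτ.2)
  have hfin : ∫⁻ τ in Ioo 0 s₁, ∫⁻ x, ‖W' τ x * ‖u τ x‖ ^ 2 +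
      W τ x * (2 * ⟪timeDerivWithin (Icc 0 s₁) u τ x, u τ x⟫)‖ₑ < ∞ := by
    have hslice : ∀ τ ∈ Ioo 0 s₁, ∫⁻ x, ‖W' τ x * ‖u τ x‖ ^ 2 +
        W τ x * (2 * ⟪timeDerivWithin (Icc 0 s₁) u τ x, u τ x⟫)‖ₑ ≤
          ENNReal.ofReal (∫ x : EuclideanSpace ℝ (Fin 3), A * (1 + ‖x‖) ^ (-(5 : ℝ))) := by
      intro τ hτ
      rw [ofReal_integral_eq_lintegral_ofReal hBint (ae_of_all _ hBnn)]
      refine lintegral_mono fun x => ?_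
      rw [← ofReal_norm]
      exact ENNReal.ofReal_le_ofReal (hdom τ ⟨hτ.1.le, hτ.2.le⟩ x)
    calc _ ≤ ∫⁻ _ in Ioo 0 s₁, ENNReal.ofReal (∫ x : EuclideanSpace ℝ (Fin 3), A * (1 + ‖x‖) ^ (-(5 : ℝ))) :=
          setLIntegral_mono' measurableSet_Ioo hslice
      _ < ∞ := by
          rw [setLIntegral_const, Real.volume_Ioo]
          exact ENNReal.mul_lt_top ENNReal.ofReal_lt_top ENNReal.ofReal_lt_top
  -- the end energies
  have hI : ∀ s ∈ Icc 0 s₁, Integrable fun x => W s x * ‖u s x‖ ^ 2 := fun s hs' =>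
    integrable_weight_mul (integrable_norm_sq (hcl.contDiff_velocity (hsub hs')).continuous (h0 s (hsub hs')))
      ((continuous_heatKernel _).comp (continuous_id.sub continuous_const)) (hWb s hs'.2)
  have key := integral_Ioo_integral_weightedEnergy_deriv hcl₁.smooth_velocity hs₁ hWc hWsc hWd le_rfl hs₁.le le_rfl
    hfin (hI 0 ⟨le_rfl, hs₁.le⟩) (hI s₁ ⟨hs₁.le, le_rfl⟩)
  have hend : (∫ x, W s₁ x * ‖u s₁ x‖ ^ 2) - ∫ x, W 0 x * ‖u 0 x‖ ^ 2 =
      (∫ x, heatKernel (ν * (t - s₁)) (x 2 - c₀) * ‖u s₁ x‖ ^ 2) - ∫ x, heatKernel (ν * t) (x 2 - c₀) * ‖u 0 x‖ ^ 2 := by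
    simp [hW]
  rw [← hend, ← key]
  refine setIntegral_congr_fun measurableSet_Ioo fun τ hτ => ?_
  have hτ' : τ ∈ Icc 0 s₁ := ⟨hτ.1.le, hτ.2.le⟩
  simp_rw [timeDerivWithin_eq_acc hcl₁ hτ']
  rfl

/-! ### The planar energies: continuity in the offset, bounds, Lipschitz continuity in time -/

/-- `(1 + ‖(y₀,y₁,c)‖)⁻ʳ ≤ (1 + ‖y‖)⁻ʳ` for `r ≥ 0`. -/
theorem rpow_neg_toLp_vec3_le (y : EuclideanSpace ℝ (Fin 2)) (c : ℝ) {r : ℝ} (hr : 0 ≤ r) :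
    (1 + ‖(toLp 2 ![y 0, y 1, c] : EuclideanSpace ℝ (Fin 3))‖) ^ (-r) ≤ (1 + ‖y‖) ^ (-r) :=
  Real.rpow_le_rpow_of_nonpos (by positivity) (by linarith [norm_le_norm_toLp_vec3 y c]) (by linarith)

/-- **The planar energy is continuous in the offset**: for continuous `v` with
`‖v x‖ ≤ C(1+‖x‖)⁻³`, `c ↦ ∫_y ‖v(y₀,y₁,c)‖²` is continuous (dominated convergence). -/
theorem continuous_planarEnergy {v : EuclideanSpace ℝ (Fin 3) → EuclideanSpace ℝ (Fin 3)} (hv : Continuous v)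
    (h0 : ∀ x, ‖v x‖ ≤ C * (1 + ‖x‖) ^ (-(3 : ℝ))) :
    Continuous fun c : ℝ => ∫ y : EuclideanSpace ℝ (Fin 2), ‖v (toLp 2 ![y 0, y 1, c])‖ ^ 2 := by
  have hr : (Module.finrank ℝ (EuclideanSpace ℝ (Fin 2)) : ℝ) < 6 := by
    rw [finrank_euclideanSpace, Fintype.card_fin]; norm_num
  refine continuous_of_dominated (bound := fun y => C ^ 2 * (1 + ‖y‖) ^ (-(6 : ℝ))) (fun c => ?_)
    (fun c => ae_of_all _ fun y => ?_) ((integrable_one_add_norm hr).const_mul _) (ae_of_all _ fun y => ?_)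
  · exact ((hv.comp (continuous_toLp_vec3_left c)).norm.pow 2).aestronglyMeasurable
  · rw [Real.norm_of_nonneg (sq_nonneg _)]
    exact (norm_sq_le_weight (h0 _)).trans
      (mul_le_mul_of_nonneg_left (rpow_neg_toLp_vec3_le y c (by norm_num)) (sq_nonneg C))
  · have hc : Continuous fun c : ℝ => (toLp 2 ![y 0, y 1, c] : EuclideanSpace ℝ (Fin 3)) := by
      have : (fun c : ℝ => (toLp 2 ![y 0, y 1, c] : EuclideanSpace ℝ (Fin 3))) =
          fun c => toLp 2 ![y 0, y 1, 0] + c • EuclideanSpace.single 2 1 :=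
        funext fun c => toLp_vec3_eq_add_smul y c
      rw [this]; fun_prop
    exact (hv.comp hc).norm.pow 2

/-- **The planar energies are bounded**: `∫_y ‖v(y₀,y₁,c)‖² ≤ C² ∫ (1+‖y‖)⁻⁶`. -/
theorem planarEnergy_le {v : EuclideanSpace ℝ (Fin 3) → EuclideanSpace ℝ (Fin 3)}
    (h0 : ∀ x, ‖v x‖ ≤ C * (1 + ‖x‖) ^ (-(3 : ℝ))) (c : ℝ) :
    ∫ y : EuclideanSpace ℝ (Fin 2), ‖v (toLp 2 ![y 0, y 1, c])‖ ^ 2 ≤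
      C ^ 2 * ∫ y : EuclideanSpace ℝ (Fin 2), (1 + ‖y‖) ^ (-(6 : ℝ)) := by
  have hr : (Module.finrank ℝ (EuclideanSpace ℝ (Fin 2)) : ℝ) < 6 := by
    rw [finrank_euclideanSpace, Fintype.card_fin]; norm_num
  rw [← integral_const_mul]
  refine integral_mono_of_nonneg (ae_of_all _ fun y => sq_nonneg _) ((integrable_one_add_norm hr).const_mul _)
    (ae_of_all _ fun y => ?_)
  exact (norm_sq_le_weight (h0 _)).trans
    (mul_le_mul_of_nonneg_left (rpow_neg_toLp_vec3_le y c (by norm_num)) (sq_nonneg C))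

/-- **The planar energies are Lipschitz in time.** Along a classical solution on `[0,t]` with
order-(3,2) decay, for `s ∈ [0,t]` and every offset `c`:
`|∫_y|u(s)|² − ∫_y|u(t)|²| ≤ (2C(3νC+C²+C)∫(1+‖y‖)⁻⁵)(t − s)` — the tendency field decays like
`(1+‖x‖)⁻²` (`norm_acc_le_weight`), mean value inequality on every time line. [folklore] -/
theorem abs_planarEnergy_sub_le (hν : 0 < ν) (ht : 0 < t) (hcl : IsClassicalNSSolutionOn (Icc 0 t) ν 0 u p)
    (h0 : ∀ s ∈ Icc 0 t, ∀ x, ‖u s x‖ ≤ C * (1 + ‖x‖) ^ (-(3 : ℝ)))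
    (h1 : ∀ s ∈ Icc 0 t, ∀ x, ‖fderiv ℝ (u s) x‖ ≤ C * (1 + ‖x‖) ^ (-(3 : ℝ)))
    (h2 : ∀ s ∈ Icc 0 t, ∀ x, ‖iteratedFDeriv ℝ 2 (u s) x‖ ≤ C * (1 + ‖x‖) ^ (-(3 : ℝ)))
    (k1 : ∀ s ∈ Icc 0 t, ∀ x, ‖gradient (p s) x‖ ≤ C * (1 + ‖x‖) ^ (-(2 : ℝ)))
    {s : ℝ} (hs : s ∈ Icc 0 t) (c : ℝ) :
    |(∫ y : EuclideanSpace ℝ (Fin 2), ‖u s (toLp 2 ![y 0, y 1, c])‖ ^ 2) -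
        ∫ y : EuclideanSpace ℝ (Fin 2), ‖u t (toLp 2 ![y 0, y 1, c])‖ ^ 2| ≤
      (2 * C * (3 * ν * C + C ^ 2 + C) * ∫ y : EuclideanSpace ℝ (Fin 2), (1 + ‖y‖) ^ (-(5 : ℝ))) * (t - s) := by
  have hC : 0 ≤ C := nonneg_of_norm_le_rpow (h0 0 ⟨le_rfl, ht.le⟩)
  have hU : UniqueDiffOn ℝ (Icc 0 t) := uniqueDiffOn_Icc ht
  have hsm := hcl.smooth_velocity
  have htt : t ∈ Icc 0 t := ⟨ht.le, le_rfl⟩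
  have hA : 0 ≤ 3 * ν * C + C ^ 2 + C := by positivity
  -- the mean value inequality on every time line
  have hpt : ∀ x, |‖u s x‖ ^ 2 - ‖u t x‖ ^ 2| ≤ 2 * C * (3 * ν * C + C ^ 2 + C) * (1 + ‖x‖) ^ (-(5 : ℝ)) * (t - s) := by
    intro x
    have hderiv : ∀ τ ∈ Icc 0 t, HasDerivWithinAt (fun τ => ‖u τ x‖ ^ 2)
        (2 * ⟪u τ x, timeDerivWithin (Icc 0 t) u τ x⟫) (Icc 0 t) τ := fun τ hτ =>
      (hsm.hasDerivWithinAt_timeDerivWithin hU hτ x).norm_sq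
    have hbound : ∀ τ ∈ Icc 0 t, ‖2 * ⟪u τ x, timeDerivWithin (Icc 0 t) u τ x⟫‖ ≤
        2 * C * (3 * ν * C + C ^ 2 + C) * (1 + ‖x‖) ^ (-(5 : ℝ)) := by
      intro τ hτ
      rw [timeDerivWithin_eq_acc hcl hτ x, norm_mul, Real.norm_of_nonneg zero_le_two, ← weight_two_mul_three]
      have hacc := norm_acc_le_weight hν.le hC (h0 τ hτ x) (h1 τ hτ x) (h2 τ hτ x) (k1 τ hτ x)
      calc 2 * ‖⟪u τ x, ν • Δ (u τ) x - convect (u τ) (u τ) x - gradient (p τ) x⟫‖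
          ≤ 2 * (‖u τ x‖ * ‖ν • Δ (u τ) x - convect (u τ) (u τ) x - gradient (p τ) x‖) := by
            gcongr; exact norm_inner_le_norm _ _
        _ ≤ 2 * ((C * (1 + ‖x‖) ^ (-(3 : ℝ))) * ((3 * ν * C + C ^ 2 + C) * (1 + ‖x‖) ^ (-(2 : ℝ)))) := by
            gcongr
            exact h0 τ hτ x
        _ = 2 * C * (3 * ν * C + C ^ 2 + C) * ((1 + ‖x‖) ^ (-(2 : ℝ)) * (1 + ‖x‖) ^ (-(3 : ℝ))) := by ring
    have key := (convex_Icc 0 t).norm_image_sub_le_of_norm_hasDerivWithin_le hderiv hbound hs htt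
    rw [Real.norm_eq_abs, Real.norm_eq_abs, abs_of_nonneg (sub_nonneg.2 hs.2)] at key
    rwa [abs_sub_comm]
  -- integrate over the plane
  have hint : ∀ τ ∈ Icc 0 t, Integrable fun y : EuclideanSpace ℝ (Fin 2) => ‖u τ (toLp 2 ![y 0, y 1, c])‖ ^ 2 :=
    fun τ hτ => integrable_plane_of_norm_le_rpow (g := fun x => ‖u τ x‖ ^ 2)
      ((hcl.contDiff_velocity hτ).continuous.norm.pow 2)
      (by norm_num : (2 : ℝ) < 6) (fun x => by
        rw [Real.norm_of_nonneg (sq_nonneg _)]; exact norm_sq_le_weight (h0 τ hτ x)) c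
  rw [← integral_sub (hint s hs) (hint t htt)]
  have hr5 : (Module.finrank ℝ (EuclideanSpace ℝ (Fin 2)) : ℝ) < 5 := by
    rw [finrank_euclideanSpace, Fintype.card_fin]; norm_num
  have hBint : Integrable fun y : EuclideanSpace ℝ (Fin 2) =>
      2 * C * (3 * ν * C + C ^ 2 + C) * (1 + ‖y‖) ^ (-(5 : ℝ)) * (t - s) :=
    (((integrable_one_add_norm hr5).const_mul _).mul_const _)
  calc |∫ y : EuclideanSpace ℝ (Fin 2), (‖u s (toLp 2 ![y 0, y 1, c])‖ ^ 2 - ‖u t (toLp 2 ![y 0, y 1, c])‖ ^ 2)|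
      = ‖∫ y : EuclideanSpace ℝ (Fin 2), (‖u s (toLp 2 ![y 0, y 1, c])‖ ^ 2 - ‖u t (toLp 2 ![y 0, y 1, c])‖ ^ 2)‖ :=
        (Real.norm_eq_abs _).symm
    _ ≤ ∫ y : EuclideanSpace ℝ (Fin 2), 2 * C * (3 * ν * C + C ^ 2 + C) * (1 + ‖y‖) ^ (-(5 : ℝ)) * (t - s) := by
        refine norm_integral_le_of_norm_le hBint (ae_of_all _ fun y => ?_)
        rw [Real.norm_eq_abs]
        refine (hpt _).trans (mul_le_mul_of_nonneg_right ?_ (sub_nonneg.2 hs.2))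
        exact mul_le_mul_of_nonneg_left (rpow_neg_toLp_vec3_le y c (by norm_num)) (by positivity)
    _ = (2 * C * (3 * ν * C + C ^ 2 + C) * ∫ y : EuclideanSpace ℝ (Fin 2), (1 + ‖y‖) ^ (-(5 : ℝ))) * (t - s) := by
        rw [integral_mul_const, integral_const_mul]

/-- **The caloric means of the planar energies converge**: along a classical solution on `[0,t]`
with order-(3,2) decay, `∫ (∫_y|u(s)|²)(c) G_{ν(t−s)}(c − c₀) dc → ∫_y |u(t)(y₀,y₁,c₀)|²` as `s ↑ t`
(landed `tendsto_integral_mul_heatKernel`, with the times clamped into `[0,t]`). [folklore] -/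
theorem tendsto_integral_planarEnergy_mul_heatKernel (hν : 0 < ν) (ht : 0 < t)
    (hcl : IsClassicalNSSolutionOn (Icc 0 t) ν 0 u p)
    (h0 : ∀ s ∈ Icc 0 t, ∀ x, ‖u s x‖ ≤ C * (1 + ‖x‖) ^ (-(3 : ℝ)))
    (h1 : ∀ s ∈ Icc 0 t, ∀ x, ‖fderiv ℝ (u s) x‖ ≤ C * (1 + ‖x‖) ^ (-(3 : ℝ)))
    (h2 : ∀ s ∈ Icc 0 t, ∀ x, ‖iteratedFDeriv ℝ 2 (u s) x‖ ≤ C * (1 + ‖x‖) ^ (-(3 : ℝ)))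
    (k1 : ∀ s ∈ Icc 0 t, ∀ x, ‖gradient (p s) x‖ ≤ C * (1 + ‖x‖) ^ (-(2 : ℝ))) (c₀ : ℝ) :
    Tendsto (fun s => ∫ c : ℝ, (∫ y : EuclideanSpace ℝ (Fin 2), ‖u s (toLp 2 ![y 0, y 1, c])‖ ^ 2) *
        heatKernel (ν * (t - s)) (c - c₀)) (𝓝[<] t)
      (𝓝 (∫ y : EuclideanSpace ℝ (Fin 2), ‖u t (toLp 2 ![y 0, y 1, c₀])‖ ^ 2)) := by
  have hC : 0 ≤ C := nonneg_of_norm_le_rpow (h0 0 ⟨le_rfl, ht.le⟩)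
  have htt : t ∈ Icc 0 t := ⟨ht.le, le_rfl⟩
  -- clamp the times into `[0,t]`
  set e : ℝ → ℝ → ℝ := fun s c => ∫ y : EuclideanSpace ℝ (Fin 2), ‖u (max 0 (min s t)) (toLp 2 ![y 0, y 1, c])‖ ^ 2
    with he
  have hmem : ∀ s, max 0 (min s t) ∈ Icc 0 t := fun s => ⟨le_max_left _ _, max_le ht.le (min_le_right _ _)⟩
  have hid : ∀ s ∈ Icc 0 t, max 0 (min s t) = s := fun s hs => by rw [min_eq_left hs.2, max_eq_right hs.1]
  have hcont : ∀ s, Continuous (e s) := fun s =>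
    continuous_planarEnergy (hcl.contDiff_velocity (hmem s)).continuous (h0 _ (hmem s))
  have hM : ∀ s c, ‖e s c‖ ≤ C ^ 2 * ∫ y : EuclideanSpace ℝ (Fin 2), (1 + ‖y‖) ^ (-(6 : ℝ)) := fun s c => by
    rw [Real.norm_of_nonneg (integral_nonneg fun y => sq_nonneg _)]
    exact planarEnergy_le (h0 _ (hmem s)) c
  have hL0 : 0 ≤ 2 * C * (3 * ν * C + C ^ 2 + C) * ∫ y : EuclideanSpace ℝ (Fin 2), (1 + ‖y‖) ^ (-(5 : ℝ)) := by
    have : 0 ≤ ∫ y : EuclideanSpace ℝ (Fin 2), (1 + ‖y‖) ^ (-(5 : ℝ)) :=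
      integral_nonneg fun y => (Real.rpow_pos_of_pos (by positivity) _).le
    positivity
  have hLip : ∀ s < t, ∀ c, ‖e s c - e t c‖ ≤
      (2 * C * (3 * ν * C + C ^ 2 + C) * ∫ y : EuclideanSpace ℝ (Fin 2), (1 + ‖y‖) ^ (-(5 : ℝ))) * (t - s) := by
    intro s hs c
    simp only [he, hid t htt, Real.norm_eq_abs]
    refine (abs_planarEnergy_sub_le hν ht hcl h0 h1 h2 k1 (hmem s) c).trans (mul_le_mul_of_nonneg_left ?_ hL0)
    have : s ≤ max 0 (min s t) := le_max_of_le_right (le_min le_rfl hs.le)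
    linarith
  have key := tendsto_integral_mul_heatKernel hν hcont hM hLip c₀
  simp only [he, hid t htt] at key
  refine key.congr' ?_
  filter_upwards [Ioo_mem_nhdsLT ht] with s hs
  simp only [hid s ⟨hs.1.le, hs.2.le⟩]

/-- **The caloric means of the planar energies converge, registered closed form** (sub-goal
`slabLaw_caloricMeanLimit` of stmt-NavierStokesRegularity-16855, toward `stub_slabLawMild`).
[folklore] -/
theorem slabLaw_caloricMeanLimit : ∀ (ν t : ℝ), 0 < ν → 0 < t → ∀ (u : ℝ → EuclideanSpace ℝ (Fin 3) → EuclideanSpace ℝ (Fin 3)) (p : ℝ → EuclideanSpace ℝ (Fin 3) → ℝ), Literature.Analysis.FluidPDE.IsClassicalNSSolutionOn (Set.Icc 0 t) ν 0 u p → ∀ (C : ℝ), (∀ s ∈ Set.Icc 0 t, ∀ x, ‖u s x‖ ≤ C * (1 + ‖x‖) ^ (-(3 : ℝ))) → (∀ s ∈ Set.Icc 0 t, ∀ x, ‖fderiv ℝ (u s) x‖ ≤ C * (1 + ‖x‖) ^ (-(3 : ℝ))) → (∀ s ∈ Set.Icc 0 t, ∀ x, ‖iteratedFDeriv ℝ 2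 (u s) x‖ ≤ C * (1 + ‖x‖) ^ (-(3 : ℝ))) → (∀ s ∈ Set.Icc 0 t, ∀ x, ‖gradient (p s) x‖ ≤ C * (1 + ‖x‖) ^ (-(2 : ℝ))) → ∀ (c₀ : ℝ), Filter.Tendsto (fun s => ∫ c : ℝ, (∫ y : EuclideanSpace ℝ (Fin 2), ‖u s (WithLp.toLp 2 ![y 0, y 1, c])‖ ^ 2) * Literature.Analysis.UnboundedOperators.heatKernel (ν * (t - s)) (c - c₀)) (nhdsWithin t (Set.Iio t)) (nhds (∫ y : EuclideanSpace ℝ (Fin 2), ‖u t (WithLp.toLp 2 ![y 0, y 1, c₀])‖ ^ 2)) :=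
  fun _ _ hν ht _ _ hcl _ h0 h1 h2 k1 c₀ => tendsto_integral_planarEnergy_mul_heatKernel hν ht hcl h0 h1 h2 k1 c₀

end Summit.NavierStokesRegularity.NavierStokesRegularity.Theorems.PlanarEnergyAPriori

end
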